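import Summits.FinalStateConjecture.FinalStateConjecture.Theorems.ZeroEnergyRigidity.Negative.KerrParameterSign
import Literature.Geometry.Lorentzian.KerrConvergenceProofs
import Literature.Geometry.Lorentzian.CauchyProblemCauchy

/-!
# `ZeroEnergyRigidity` (stmt-FinalStateConjecture-10690, route ZeroEnergyKerrOrBomb) —
# negative-side lemma V: the d.o.c. isometry of the conclusion is NEVER unique

Tightness lemma for the CONCLUSION of the crux (`∃ (M a), |a| < M ∧ ∃ Ψ : Kerr.exterior M a → 𝓑,
injective, range = d.o.c., isometric immersion of `Kerr.smoothMetric M a r₊`), complementing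
`KerrParameterSign.lean` (the PARAMETERS are fixed at most up to the sign of `a`): the MAP `Ψ` is
fixed at most up to the isometry group of the Kerr exterior.  Concretely, the Killing time
translation `(t*, x⃗) ↦ (t* + c, x⃗)` of the ingoing Kerr–Schild chart

* preserves the Kerr–Schild radius, the scalar `H`, the null covector `ℓ` — all functions of the
  spatial part `x⃗` only — hence the Kerr–Schild form `g = η + 2Hℓ⊗ℓ` (`bilin_shiftT`);
* restricts to a bijection `shiftExt a r₀ c` of every chart `Kerr.region a r₀` (`{r > max r₀ 0}`),
  smooth with identity differential, an isometric immersion of `Kerr.smoothMetric M a r₀` onto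
  itself (`isIsometricImmersion_shiftExt`);
* so `Ψ ∘ shiftExt a r₊ c` presents the d.o.c. whenever `Ψ` does
  (`kerrExteriorPresentation_comp_shiftExt`), and `Ψ ∘ shiftExt a r₊ 1 ≠ Ψ` because `Ψ` is
  injective and the exterior is non-empty (`[Kerr.Facts]`: it is connected):
  **`¬ ∃! Ψ`** (`not_existsUnique_kerrExteriorPresentation`) — for EVERY `𝓑`, `M`, `a`.

Consequences recorded for provers/planners: a `∃! Ψ`-strengthening of the conclusion is false;
any normalisation of `Ψ` (equivariance `dΨ(∂_{t*}) = T`, matching a marked point or slice) must be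
IMPOSED, it is not implied; together with `StationaryFieldRescaling.lean` (the normalisation of `T`
is free) this closes the list of "rigidifications" of the conclusion that hold for free: none.
No hypothesis of the crux is involved; nothing here asserts a Theses statement.  Refuter seat
`refuter-cdisprove-stmt-FinalStateConjecture-10690-g3-0` (cdisprove, cycle 3, 2026-08-16); workfile
`Cruxes/ZeroEnergyRigidity/Disproof.lean` § (b″).

## References

* B. O'Neill, *The geometry of Kerr black holes*, A K Peters 1995, Ch. 2, §2.2 (the isometry
  group of Boyer–Lindquist blocks contains the flows of `∂_t`, `∂_φ`).
* R. P. Kerr, A. Schild, Proc. Symp. Appl. Math. 17 (1965) 199 (`g = η + 2Hℓ⊗ℓ` with `H`, `ℓ`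
  independent of the Kerr–Schild time).
-/

noncomputable section

namespace Summit.FinalStateConjecture.FinalStateConjecture.Theorems.ZeroEnergyRigidity.Negative

open Set Literature.Geometry.Lorentzian
open scoped Manifold ContDiff Topology

/-! ### The time translation of the Kerr–Schild chart -/

/-- The Kerr–Schild time translation `(t*, x⃗) ↦ (t* + c, x⃗)` of `E4`. [folklore] -/
def shiftT (c : ℝ) (x : E4) : E4 := x + c • E4.basisVector 0

/-- Components of the time translation. [folklore] -/
theorem shiftT_apply (c : ℝ) (x : E4) (μ : Fin 4) :
    shiftT c x μ = x μ + (if μ = 0 then c else 0) := by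
  simp [shiftT]

/-- `(x + c e₀)⁰ = x⁰ + c`. [folklore] -/
@[simp] theorem shiftT_apply_zero (c : ℝ) (x : E4) : shiftT c x 0 = x 0 + c := by
  simp [shiftT_apply]

/-- The spatial components are unchanged. [folklore] -/
@[simp] theorem shiftT_apply_succ (c : ℝ) (x : E4) (i : Fin 3) : shiftT c x i.succ = x i.succ := by
  simp [shiftT_apply, Fin.succ_ne_zero]

/-- `(x + c e₀)¹ = x¹`. [folklore] -/
@[simp] theorem shiftT_apply_one (c : ℝ) (x : E4) : shiftT c x 1 = x 1 := shiftT_apply_succ c x 0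
/-- `(x + c e₀)² = x²`. [folklore] -/
@[simp] theorem shiftT_apply_two (c : ℝ) (x : E4) : shiftT c x 2 = x 2 := shiftT_apply_succ c x 1
/-- `(x + c e₀)³ = x³`. [folklore] -/
@[simp] theorem shiftT_apply_three (c : ℝ) (x : E4) : shiftT c x 3 = x 3 := shiftT_apply_succ c x 2

/-- Time translations compose additively; in particular `shiftT (−c)` inverts `shiftT c`.
[folklore] -/
theorem shiftT_shiftT (c d : ℝ) (x : E4) : shiftT c (shiftT d x) = shiftT (d + c) x := by
  simp only [shiftT, add_smul]
  abel

/-- `shiftT 0 = id`. [folklore] -/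
@[simp] theorem shiftT_zero (x : E4) : shiftT 0 x = x := by simp [shiftT]

/-- The spatial part is unchanged by a time translation. [folklore] -/
theorem spatial_shiftT (c : ℝ) (x : E4) : E4.spatial (shiftT c x) = E4.spatial x := by
  ext i
  rw [E4.spatial_apply, E4.spatial_apply, shiftT_apply_succ]

/-- The Kerr–Schild radius is a function of the spatial part: `r(a, x + c e₀) = r(a, x)`
(Visser arXiv:0706.0622, (35)). [folklore] -/
theorem radius_shiftT (a c : ℝ) (x : E4) : Kerr.radius a (shiftT c x) = Kerr.radius a x :=
  Kerr.radius_eq_of_spatial_eq a (spatial_shiftT c x)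

/-- `H(x + c e₀) = H(x)` for the Kerr–Schild scalar `H = Mr³/(r⁴ + a²z²)`. [folklore] -/
theorem scalarH_shiftT (M a c : ℝ) (x : E4) :
    Kerr.scalarH M a (shiftT c x) = Kerr.scalarH M a x := by
  unfold Kerr.scalarH
  rw [radius_shiftT, shiftT_apply_three]

/-- `ℓ(x + c e₀) = ℓ(x)` for the Kerr–Schild null covector (its components are functions of
`r, x¹, x², x³`). [folklore] -/
theorem nullCovector_shiftT (a c : ℝ) (x v : E4) :
    Kerr.nullCovector a (shiftT c x) v = Kerr.nullCovector a x v := by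
  simp only [Kerr.nullCovector, Kerr.nullCovectorFun, radius_shiftT, shiftT_apply_one,
    shiftT_apply_two, shiftT_apply_three]

/-- **The Kerr–Schild form is invariant under the time translation**:
`g_{M,a}(x + c e₀)(v, w) = g_{M,a}(x)(v, w)` — `∂_{t*}` is a Killing field of `g = η + 2Hℓ⊗ℓ`
(Kerr–Schild 1965). [folklore] -/
theorem bilin_shiftT (M a c : ℝ) (x v w : E4) :
    Kerr.bilin M a (shiftT c x) v w = Kerr.bilin M a x v w := by
  rw [Kerr.bilin_apply, Kerr.bilin_apply, scalarH_shiftT, nullCovector_shiftT, nullCovector_shiftT]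

/-! ### The induced isometry of the charts `Kerr.region a r₀` -/

/-- The time translation preserves every chart domain `{r > max r₀ 0}`. [folklore] -/
theorem shiftT_mem_region {a r₀ : ℝ} (c : ℝ) {x : E4} (hx : x ∈ Kerr.region a r₀) :
    shiftT c x ∈ Kerr.region a r₀ := by
  rw [Kerr.mem_region] at hx ⊢
  rwa [radius_shiftT]

/-- The time translation as a self-map of the chart `Kerr.region a r₀` (for `r₀ = r₊(M, a)` this
is the Kerr exterior `Kerr.exterior M a`, by `rfl`). [folklore] -/
def shiftExt (a r₀ c : ℝ) : Kerr.region a r₀ → Kerr.region a r₀ :=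
  fun x ↦ ⟨shiftT c x.1, shiftT_mem_region c x.2⟩

/-- `shiftExt` in coordinates. [folklore] -/
theorem coe_shiftExt (a r₀ c : ℝ) (x : Kerr.region a r₀) :
    (shiftExt a r₀ c x : E4) = shiftT c x.1 := rfl

/-- `shiftExt (−c)` is a left inverse of `shiftExt c`. [folklore] -/
theorem shiftExt_neg_shiftExt (a r₀ c : ℝ) (x : Kerr.region a r₀) :
    shiftExt a r₀ (-c) (shiftExt a r₀ c x) = x := by
  apply Subtype.ext
  simp [coe_shiftExt, shiftT_shiftT]

/-- `shiftExt` is injective. [folklore] -/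
theorem shiftExt_injective (a r₀ c : ℝ) : Function.Injective (shiftExt a r₀ c) :=
  Function.LeftInverse.injective (shiftExt_neg_shiftExt a r₀ c)

/-- `shiftExt` is surjective. [folklore] -/
theorem shiftExt_surjective (a r₀ c : ℝ) : Function.Surjective (shiftExt a r₀ c) := by
  intro y
  refine ⟨shiftExt a r₀ (-c) y, ?_⟩
  have := shiftExt_neg_shiftExt a r₀ (-c) y
  rwa [neg_neg] at this

/-- `shiftExt` is smooth (an affine map between open submanifolds of `E4`). [folklore] -/
theorem contMDiff_shiftExt (a r₀ c : ℝ) : ContMDiff 𝓘(ℝ, E4) 𝓘(ℝ, E4) ∞ (shiftExt a r₀ c) := by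
  rw [← ContMDiff.subtypeVal_comp_iff]
  have h : (Subtype.val ∘ shiftExt a r₀ c) = fun x : Kerr.region a r₀ ↦ x.1 + c • E4.basisVector 0 :=
    rfl
  rw [h]
  exact contMDiff_subtype_val.add contMDiff_const

/-- The differential of `shiftExt` is the identity (charts of open submanifolds are restrictions
of the identity: `OpensChart.mfderiv_codRestrict`, `OpensChart.mfderiv_eq`). [folklore] -/
theorem mfderiv_shiftExt (a r₀ c : ℝ) (x : Kerr.region a r₀) :
    mfderiv 𝓘(ℝ, E4) 𝓘(ℝ, E4) (shiftExt a r₀ c) x = ContinuousLinearMap.id ℝ E4 := by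
  have hf : ∀ y : Kerr.region a r₀,
      (fun y : Kerr.region a r₀ ↦ shiftT c y.1) y = shiftT c y.1 := fun _ ↦ rfl
  have hΦ : DifferentiableAt ℝ (shiftT c) x.1 :=
    differentiableAt_id.add (differentiableAt_const _)
  have hd : MDifferentiableAt 𝓘(ℝ, E4) 𝓘(ℝ, E4)
      (fun y : Kerr.region a r₀ ↦ shiftT c y.1) x :=
    (OpensChart.mdifferentiableAt_iff x _ (shiftT c) hf).2 hΦ
  rw [OpensChart.mfderiv_codRestrict (φ := shiftExt a r₀ c)
    (f := fun y : Kerr.region a r₀ ↦ shiftT c y.1) (fun _ ↦ rfl) hd,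
    OpensChart.mfderiv_eq x _ (shiftT c) hf hΦ]
  have hs : shiftT c = fun y : E4 ↦ y + c • E4.basisVector 0 := rfl
  rw [hs, fderiv_add_const, fderiv_fun_id]

/-- **The time translation is an isometry of every Kerr–Schild chart**: an isometric immersion
(indeed a bijective one, `shiftExt_injective`/`shiftExt_surjective`) of the smooth Kerr metric
`Kerr.smoothMetric M a r₀` onto itself.  O'Neill 1995, Ch. 2, §2.2. [folklore] -/
theorem isIsometricImmersion_shiftExt [Kerr.Facts] (M a r₀ c : ℝ) :
    PseudoRiemannianMetric.IsIsometricImmersion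
      (Kerr.smoothMetric M a r₀).toPseudoRiemannianMetric
      (Kerr.smoothMetric M a r₀).toPseudoRiemannianMetric (shiftExt a r₀ c) := by
  refine ⟨contMDiff_shiftExt a r₀ c, fun y ↦ ?_⟩
  ext v w
  rw [pullbackBilin_apply, mfderiv_shiftExt]
  change Kerr.bilin M a (shiftT c y.1) v w = Kerr.bilin M a y.1 v w
  exact bilin_shiftT M a c y.1 v w

/-! ### Consequence for the conclusion of the crux -/

/-- Precomposing a presentation of the d.o.c. with the time translation gives a presentation.
[folklore] -/
theorem kerrExteriorPresentation_comp_shiftExt (𝓑 : StationaryAFBlackHole.{0}) [Kerr.Facts]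
    {M a : ℝ} (c : ℝ) {Ψ : Kerr.region a (Kerr.rPlus M a) → 𝓑.carrier}
    (hinj : Function.Injective Ψ) (hrange : Set.range Ψ = 𝓑.doc)
    (hiso : PseudoRiemannianMetric.IsIsometricImmersion
      (Kerr.smoothMetric M a (Kerr.rPlus M a)).toPseudoRiemannianMetric
      𝓑.metric.toPseudoRiemannianMetric Ψ) :
    Function.Injective (Ψ ∘ shiftExt a (Kerr.rPlus M a) c) ∧
      Set.range (Ψ ∘ shiftExt a (Kerr.rPlus M a) c) = 𝓑.doc ∧
      PseudoRiemannianMetric.IsIsometricImmersion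
        (Kerr.smoothMetric M a (Kerr.rPlus M a)).toPseudoRiemannianMetric
        𝓑.metric.toPseudoRiemannianMetric (Ψ ∘ shiftExt a (Kerr.rPlus M a) c) := by
  refine ⟨hinj.comp (shiftExt_injective _ _ _), ?_,
    hiso.comp (isIsometricImmersion_shiftExt M a _ c)⟩
  rw [Set.range_comp, (shiftExt_surjective _ _ _).range_eq, Set.image_univ, hrange]

/-- **Tightness: the d.o.c. isometry of the conclusion is never unique.**  For every `𝓑`, `M`,
`a`: there is no UNIQUE `Ψ : Kerr.exterior M a → 𝓑` which is injective with range `𝓑.doc` and an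
isometric immersion of `Kerr.smoothMetric M a r₊` — if `Ψ` is one, so is `Ψ ∘ shiftExt a r₊ 1`, and
the two differ at every point of the (non-empty, `[Kerr.Facts]`) exterior since `Ψ` is injective
and `t* ↦ t* + 1` moves every point.  (Exterior-typed spelling of the `∃ Ψ`-clause of
`ZeroEnergyRigidity` / `KerrOrBomb`: `Kerr.exterior M a = Kerr.region a (r₊(M,a))` by `rfl`.)
[folklore] -/
theorem not_existsUnique_kerrExteriorPresentation (𝓑 : StationaryAFBlackHole.{0}) [Kerr.Facts]
    (M a : ℝ) :
    ¬ ∃! Ψ : Kerr.region a (Kerr.rPlus M a) → 𝓑.carrier, Function.Injective Ψ ∧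
        Set.range Ψ = 𝓑.doc ∧
        PseudoRiemannianMetric.IsIsometricImmersion
          (Kerr.smoothMetric M a (Kerr.rPlus M a)).toPseudoRiemannianMetric
          𝓑.metric.toPseudoRiemannianMetric Ψ := by
  rintro ⟨Ψ, ⟨hinj, hrange, hiso⟩, huniq⟩
  have h1 : Ψ ∘ shiftExt a (Kerr.rPlus M a) 1 = Ψ :=
    huniq _ (kerrExteriorPresentation_comp_shiftExt 𝓑 1 hinj hrange hiso)
  haveI := Kerr.connectedSpace_region a (Kerr.rPlus M a)
  obtain ⟨x⟩ := (inferInstance : Nonempty (Kerr.region a (Kerr.rPlus M a)))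
  have h2 : shiftExt a (Kerr.rPlus M a) 1 x = x := hinj (congrFun h1 x)
  have h3 := congrArg (fun z : Kerr.region a (Kerr.rPlus M a) ↦ (z : E4) 0) h2
  simp [coe_shiftExt] at h3

/-- The same, phrased with `KerrExteriorPresentation` (`KerrParameterSign.lean`): whenever the
d.o.c. is presented by the Kerr exterior `(M, a)`, it is presented by two DIFFERENT maps.
[folklore] -/
theorem exists_ne_of_kerrExteriorPresentation (𝓑 : StationaryAFBlackHole.{0}) [Kerr.Facts]
    {M a : ℝ} (h : KerrExteriorPresentation 𝓑 M a) :
    ∃ Ψ₁ Ψ₂ : Kerr.region a (Kerr.rPlus M a) → 𝓑.carrier, Ψ₁ ≠ Ψ₂ ∧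
      (Function.Injective Ψ₁ ∧ Set.range Ψ₁ = 𝓑.doc ∧
        PseudoRiemannianMetric.IsIsometricImmersion
          (Kerr.smoothMetric M a (Kerr.rPlus M a)).toPseudoRiemannianMetric
          𝓑.metric.toPseudoRiemannianMetric Ψ₁) ∧
      (Function.Injective Ψ₂ ∧ Set.range Ψ₂ = 𝓑.doc ∧
        PseudoRiemannianMetric.IsIsometricImmersion
          (Kerr.smoothMetric M a (Kerr.rPlus M a)).toPseudoRiemannianMetric
          𝓑.metric.toPseudoRiemannianMetric Ψ₂) := by
  obtain ⟨Ψ, hinj, hrange, hiso⟩ := h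
  refine ⟨Ψ, Ψ ∘ shiftExt a (Kerr.rPlus M a) 1, fun heq ↦ ?_, ⟨hinj, hrange, hiso⟩,
    kerrExteriorPresentation_comp_shiftExt 𝓑 1 hinj hrange hiso⟩
  haveI := Kerr.connectedSpace_region a (Kerr.rPlus M a)
  obtain ⟨x⟩ := (inferInstance : Nonempty (Kerr.region a (Kerr.rPlus M a)))
  have h2 : shiftExt a (Kerr.rPlus M a) 1 x = x := hinj (congrFun heq x).symm
  have h3 := congrArg (fun z : Kerr.region a (Kerr.rPlus M a) ↦ (z : E4) 0) h2
  simp [coe_shiftExt] at h3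

end Summit.FinalStateConjecture.FinalStateConjecture.Theorems.ZeroEnergyRigidity.Negative

end
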